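import Summits.BirchSwinnertonDyer.BirchSwinnertonDyer.Theorems.SignedLowerHalvesSprungLowerDivisibilityAtThreeSlopeSeparation
import HarnessLib

/-!
# Crux `SprungLowerDivisibilityAtThree` (item stmt-BirchSwinnertonDyer-19875), line `chromatic-common-zeros`:
# SECOND-ORDER (residual) separation in `Λ = ℤ_p⟦T⟧` — two elements with `μ = 0`, leading valuation `1` and
# the SAME `λ` are still coprime when their leading residues disagree:
# `‖F_0·G_λ − G_0·F_λ‖ = 1/p` ⟹ no common zero, no common height-one prime (pure `p`-adic algebra, any `p`)

Cell `bsd-ssimc` (host) / lead `cruxlead-stmt-BirchSwinnertonDyer-19875`; width seat `-w3` (gen 3);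
`--supports` 19875 `--as helper`; THEOREMS ONLY (no definition, no named fact, nothing about any curve
asserted); closes no item; BSD / K1 / leaf X8 are NOT proved by anything here.

Sequel of `…SlopeSeparation.lean` (p624687). There, two elements `F, G` with `μ = 0`,
`‖F(0)‖ = ‖G(0)‖ = 1/p` and `λ(F) ≠ λ(G)` were shown coprime (their zeros live on different circles
`|z|^{λ} = 1/p`). When `λ(F) = λ(G) = λ` the zeros of both lie on the SAME circle `|z|^λ = 1/p`, and the
first-order test is silent (x8 R5 table: 34 of the 217 census cells, verdicts `coprime@n5`/`suspect`). This
file proves the next test: on that circle `G(z) ≡ G_0 + G_λ z^λ` modulo terms of absolute value `< 1/p`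
(§1), so a common zero forces the two leading binomials `F_0 + F_λ w`, `G_0 + G_λ w` (`w = z^λ`) to be
simultaneously small, whence `‖F_0 G_λ − G_0 F_λ‖ < 1/p`; the CERTIFICATE `‖F_0·G_λ − G_0·F_λ‖ = 1/p`
— one residue class mod `p` per function: the leading unit coefficient `G_λ mod p` against `G_0/p mod p` —
therefore excludes a common zero (§2) and a common height-one prime (§3). It is the first step of the
`p`-adic resultant, in exact residue arithmetic.

## What is proved (`G(z) = ∑ ι(G_k) z^k` for `|z| < 1` in `ℂ_p`)

* §0 `norm_tsum_sub_two_le` — removing two terms from the evaluation series: if every term other than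
  `k = i, j` has absolute value `≤ δ`, then `‖G(z) − (ι(G_i)z^i + ι(G_j)z^j)‖ ≤ δ`.
* §1 `norm_leading_binomial_lt_of_hasSum_zero` — `μ(G) = 0`, `‖G_0‖ = 1/p`, `G(z) = 0`, `|z| < 1` ⟹
  `‖ι(G_0) + ι(G_λ) z^{λ(G)}‖ < 1/p` (the other terms are `≤ |z|/p`).
* §2 `not_common_zero_of_residual` — `F, G` with `μ = 0`, `‖F_0‖ = ‖G_0‖ = 1/p`, `λ(F) = λ(G)` and
  **`‖F_0·G_{λ} − G_0·F_{λ}‖ = 1/p`**: no common zero in the open unit disc.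
* §3 `not_mem_and_mem_of_residual` — hence no height-one prime of `Λ` contains both; the `T`-shifted form
  `not_mem_and_mem_of_X_mul_of_residual`; and the DISJUNCTIVE form `not_mem_and_mem_of_lam_ne_or_residual`
  (first- or second-order separation).

References (ATTRIBUTION): [Koblitz1984] Ch. IV §3–§4 (Newton polygons; the leading form on a circle of
roots); [Washington1997] §7.1–7.2, Thm. 7.3, §13.2; [Lang1990] Ch. 5 §2. Tree: `…SlopeSeparation.lean`,
`Rank1Residual/Iwasawa/LambdaInvariant*`, `Literature/…/PAdicPowerSeriesZeros.lean`.
-/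

set_option autoImplicit false
-- justification: the mandated namespace `Summit.BirchSwinnertonDyer.BirchSwinnertonDyer.Theorems`
-- (single-conjunct summit, Sub = Summit) repeats a segment by design (D-0017).
set_option linter.dupNamespace false

noncomputable section

open scoped Classical

open Polynomial Literature.NumberTheory.EllipticCurves
  Summit.BirchSwinnertonDyer.Rank1Residual.X1.MuLambda
  Summit.BirchSwinnertonDyer.Rank1Residual.Iwasawa

namespace Summit.BirchSwinnertonDyer.BirchSwinnertonDyer.Theorems.ChromaticSlopeSeparation

variable {p : ℕ} [hp : Fact p.Prime]

/-! ## §0. Removing two terms from the evaluation series -/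

section TwoTerms

/-- **Two-term remainder bound.** For `G ∈ Λ`, `|z| < 1`, indices `i ≠ j` and `δ ≥ 0` bounding every term
other than `k = i, j`: `‖G(z) − (ι(G_i) z^i + ι(G_j) z^j)‖ ≤ δ`. [cite: Koblitz1984, Ch. IV §4 (Newton polygon of a power series)] -/
theorem norm_tsum_sub_two_le (G : IwasawaAlgebra p) {z : ℂ_[p]} (hz : ‖z‖ < 1) {i j : ℕ} (hij : i ≠ j)
    {δ : ℝ} (hδ0 : 0 ≤ δ)
    (hother : ∀ k, k ≠ i → k ≠ j →
      ‖((algebraMap ℚ_[p] ℂ_[p]).comp (algebraMap ℤ_[p] ℚ_[p])) (PowerSeries.coeff k G) * z ^ k‖ ≤ δ) :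
    ‖(∑' k, ((algebraMap ℚ_[p] ℂ_[p]).comp (algebraMap ℤ_[p] ℚ_[p])) (PowerSeries.coeff k G) * z ^ k) -
      (((algebraMap ℚ_[p] ℂ_[p]).comp (algebraMap ℤ_[p] ℚ_[p])) (PowerSeries.coeff i G) * z ^ i +
        ((algebraMap ℚ_[p] ℂ_[p]).comp (algebraMap ℤ_[p] ℚ_[p])) (PowerSeries.coeff j G) * z ^ j)‖ ≤ δ := by
  set ιZ : ℤ_[p] →+* ℂ_[p] := (algebraMap ℚ_[p] ℂ_[p]).comp (algebraMap ℤ_[p] ℚ_[p]) with hιZ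
  set a : ℕ → ℂ_[p] := fun k ↦ ιZ (PowerSeries.coeff k G) * z ^ k with ha
  have hsum : Summable a := summable_map_coeff_mul_pow ιZ (norm_algebraMap_coeff_le_one G) hz
  -- remove the term `i`, then the term `j`
  set b : ℕ → ℂ_[p] := fun k ↦ ite (k = i) 0 (a k) with hb
  have hb' : b = Function.update a i 0 := by
    funext k
    rw [hb, Function.update_apply]
  have hsumb : Summable b := by rw [hb']; exact hsum.update i 0
  have h1 : ∑' k, a k = a i + ∑' k, b k := hsum.tsum_eq_add_tsum_ite i
  have h2 : ∑' k, b k = b j + ∑' k, ite (k = j) 0 (b k) := hsumb.tsum_eq_add_tsum_ite j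
  have hbj : b j = a j := by rw [hb]; exact if_neg hij.symm
  have hrest : ‖∑' k, ite (k = j) 0 (b k)‖ ≤ δ := by
    refine IsUltrametricDist.norm_tsum_le_of_forall_le_of_nonneg hδ0 fun k ↦ ?_
    by_cases hkj : k = j
    · rw [if_pos hkj, norm_zero]; exact hδ0
    · rw [if_neg hkj, hb]
      dsimp only
      by_cases hki : k = i
      · rw [if_pos hki, norm_zero]; exact hδ0
      · rw [if_neg hki]; exact hother k hki hkj
  change ‖(∑' k, a k) - (a i + a j)‖ ≤ δ
  rw [h1, h2, hbj, show a i + (a j + ∑' k, ite (k = j) 0 (b k)) - (a i + a j) =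
    ∑' k, ite (k = j) 0 (b k) by ring]
  exact hrest

end TwoTerms

/-! ## §1. On the circle of zeros the leading binomial is small -/

section Leading

/-- **The leading binomial at a zero.** For `G ∈ Λ ∖ {0}` with `μ(G) = 0` and `‖G_0‖ = 1/p`, at a zero
`z` of `G` in the open disc (so `|z|^{λ(G)} = 1/p`): `‖ι(G_0) + ι(G_{λ(G)}) z^{λ(G)}‖ < 1/p` — every other
term has absolute value `≤ |z|/p`: for `0 < k < λ`, `|G_k||z|^k ≤ (1/p)|z|`; for `k > λ`,
`|z|^k ≤ |z|^λ·|z| = |z|/p`. [cite: Koblitz1984, Ch. IV §4 (Newton polygon of a power series)] [cite: Washington1997, §7.1–7.2] -/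
theorem norm_leading_binomial_lt_of_hasSum_zero {G : IwasawaAlgebra p} (hG0 : G ≠ 0) (hμ : mu G = 0)
    (h0 : ‖PowerSeries.constantCoeff G‖ = (p : ℝ)⁻¹) {z : ℂ_[p]} (hz : ‖z‖ < 1)
    (hsum : HasSum (fun k ↦ ((algebraMap ℚ_[p] ℂ_[p]).comp (algebraMap ℤ_[p] ℚ_[p]))
      (PowerSeries.coeff k G) * z ^ k) 0) :
    ‖((algebraMap ℚ_[p] ℂ_[p]).comp (algebraMap ℤ_[p] ℚ_[p])) (PowerSeries.coeff 0 G) +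
      ((algebraMap ℚ_[p] ℂ_[p]).comp (algebraMap ℤ_[p] ℚ_[p])) (PowerSeries.coeff (lam G) G) *
        z ^ lam G‖ < (p : ℝ)⁻¹ := by
  set ιZ : ℤ_[p] →+* ℂ_[p] := (algebraMap ℚ_[p] ℂ_[p]).comp (algebraMap ℤ_[p] ℚ_[p]) with hιZ
  obtain ⟨hq0, hq1⟩ := inv_prime_pos_and_lt_one (p := p)
  have hlam1 : 1 ≤ lam G := one_le_lam_of_norm_constantCoeff_eq_inv hG0 hμ h0
  have hzl : ‖z‖ ^ lam G = (p : ℝ)⁻¹ := norm_pow_lam_eq_inv_of_hasSum_zero hG0 hμ h0 hz hsum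
  have hs0 : 0 ≤ ‖z‖ := norm_nonneg _
  -- the uniform bound `δ = |z|/p` on the other terms
  set δ : ℝ := (p : ℝ)⁻¹ * ‖z‖ with hδ
  have hδ0 : 0 ≤ δ := mul_nonneg hq0.le hs0
  have hδlt : δ < (p : ℝ)⁻¹ := by
    calc (p : ℝ)⁻¹ * ‖z‖ < (p : ℝ)⁻¹ * 1 := mul_lt_mul_of_pos_left hz hq0
      _ = (p : ℝ)⁻¹ := mul_one _
  have hother : ∀ k, k ≠ 0 → k ≠ lam G → ‖ιZ (PowerSeries.coeff k G) * z ^ k‖ ≤ δ := by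
    intro k hk0 hkl
    rw [norm_mul, norm_pow]
    rcases lt_or_gt_of_ne hkl with hlt | hgt
    · -- `0 < k < λ`: `|G_k| ≤ 1/p`, `|z|^k ≤ |z|`
      calc ‖ιZ (PowerSeries.coeff k G)‖ * ‖z‖ ^ k ≤ (p : ℝ)⁻¹ * ‖z‖ ^ 1 :=
            mul_le_mul (norm_coeff_le_inv_of_lt_lam hG0 hμ hlt)
              (pow_le_pow_of_le_one hs0 hz.le (Nat.one_le_iff_ne_zero.mpr hk0))
              (pow_nonneg hs0 _) hq0.le
        _ = δ := by rw [pow_one]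
    · -- `k > λ`: `|G_k| ≤ 1`, `|z|^k ≤ |z|^{λ+1} = |z|/p`
      calc ‖ιZ (PowerSeries.coeff k G)‖ * ‖z‖ ^ k ≤ 1 * ‖z‖ ^ (lam G + 1) :=
            mul_le_mul (norm_algebraMap_coeff_le_one G k) (pow_le_pow_of_le_one hs0 hz.le hgt)
              (pow_nonneg hs0 _) zero_le_one
        _ = δ := by rw [one_mul, pow_succ, hzl]
  have hbound := norm_tsum_sub_two_le G hz (show (0 : ℕ) ≠ lam G by omega) hδ0 hother
  rw [hsum.tsum_eq, zero_sub, norm_neg, pow_zero, mul_one] at hbound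
  exact lt_of_le_of_lt hbound hδlt

end Leading

/-! ## §2. Two functions with the same `λ`: the residual separation -/

section Residual

/-- **RESIDUAL (second-order) SEPARATION.** For `F, G ∈ Λ ∖ {0}` with `μ(F) = μ(G) = 0`,
`‖F_0‖ = ‖G_0‖ = 1/p`, `λ(F) = λ(G) =: λ` and the certificate **`‖F_0·G_λ − G_0·F_λ‖ = 1/p`** (the residues
`(F_0/p)·G_λ` and `(G_0/p)·F_λ` disagree mod `p`), no `z` of the open unit disc of `ℂ_p` is a common zero:
with `w = z^λ` both `‖F_0 + F_λ w‖` and `‖G_0 + G_λ w‖` would be `< 1/p` (§1), and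
`F_0 G_λ − G_0 F_λ = G_λ(F_0 + F_λ w) − F_λ(G_0 + G_λ w)` would have absolute value `< 1/p`.
[cite: Koblitz1984, Ch. IV §4 (Newton polygon of a power series)] [cite: Washington1997, §7.1–7.2 and Thm. 7.3] -/
theorem not_common_zero_of_residual {F G : IwasawaAlgebra p} (hF0 : F ≠ 0) (hG0 : G ≠ 0)
    (hμF : mu F = 0) (hμG : mu G = 0)
    (hF : ‖PowerSeries.constantCoeff F‖ = (p : ℝ)⁻¹) (hG : ‖PowerSeries.constantCoeff G‖ = (p : ℝ)⁻¹)
    (hlam : lam F = lam G)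
    (hres : ‖PowerSeries.constantCoeff F * PowerSeries.coeff (lam G) G -
      PowerSeries.constantCoeff G * PowerSeries.coeff (lam F) F‖ = (p : ℝ)⁻¹)
    {z : ℂ_[p]} (hz : ‖z‖ < 1)
    (hFz : HasSum (fun k ↦ ((algebraMap ℚ_[p] ℂ_[p]).comp (algebraMap ℤ_[p] ℚ_[p]))
      (PowerSeries.coeff k F) * z ^ k) 0)
    (hGz : HasSum (fun k ↦ ((algebraMap ℚ_[p] ℂ_[p]).comp (algebraMap ℤ_[p] ℚ_[p]))
      (PowerSeries.coeff k G) * z ^ k) 0) : False := by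
  set ιZ : ℤ_[p] →+* ℂ_[p] := (algebraMap ℚ_[p] ℂ_[p]).comp (algebraMap ℤ_[p] ℚ_[p]) with hιZ
  have hF' := norm_leading_binomial_lt_of_hasSum_zero hF0 hμF hF hz hFz
  have hG' := norm_leading_binomial_lt_of_hasSum_zero hG0 hμG hG hz hGz
  rw [hlam] at hF'
  set w : ℂ_[p] := z ^ lam G with hw
  -- the identity `ι(F_0 G_λ − G_0 F_λ) = ι(G_λ)(ι F_0 + ι F_λ w) − ι(F_λ)(ι G_0 + ι G_λ w)`
  have hid : ιZ (PowerSeries.constantCoeff F * PowerSeries.coeff (lam G) G -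
      PowerSeries.constantCoeff G * PowerSeries.coeff (lam F) F) =
      ιZ (PowerSeries.coeff (lam G) G) * (ιZ (PowerSeries.coeff 0 F) + ιZ (PowerSeries.coeff (lam G) F) * w) -
      ιZ (PowerSeries.coeff (lam G) F) * (ιZ (PowerSeries.coeff 0 G) + ιZ (PowerSeries.coeff (lam G) G) * w) := by
    rw [hlam, map_sub, map_mul, map_mul, ← PowerSeries.coeff_zero_eq_constantCoeff_apply,
      ← PowerSeries.coeff_zero_eq_constantCoeff_apply]
    ring
  have hnorm : ‖ιZ (PowerSeries.constantCoeff F * PowerSeries.coeff (lam G) G -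
      PowerSeries.constantCoeff G * PowerSeries.coeff (lam F) F)‖ < (p : ℝ)⁻¹ := by
    rw [hid, sub_eq_add_neg]
    refine lt_of_le_of_lt (IsUltrametricDist.norm_add_le_max _ _) (max_lt ?_ ?_)
    · rw [norm_mul]
      calc ‖ιZ (PowerSeries.coeff (lam G) G)‖ *
            ‖ιZ (PowerSeries.coeff 0 F) + ιZ (PowerSeries.coeff (lam G) F) * w‖
          ≤ 1 * ‖ιZ (PowerSeries.coeff 0 F) + ιZ (PowerSeries.coeff (lam G) F) * w‖ :=
            mul_le_mul_of_nonneg_right (norm_algebraMap_coeff_le_one G _) (norm_nonneg _)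
        _ < (p : ℝ)⁻¹ := by rw [one_mul]; exact hF'
    · rw [norm_neg, norm_mul]
      calc ‖ιZ (PowerSeries.coeff (lam G) F)‖ *
            ‖ιZ (PowerSeries.coeff 0 G) + ιZ (PowerSeries.coeff (lam G) G) * w‖
          ≤ 1 * ‖ιZ (PowerSeries.coeff 0 G) + ιZ (PowerSeries.coeff (lam G) G) * w‖ :=
            mul_le_mul_of_nonneg_right (norm_algebraMap_coeff_le_one F _) (norm_nonneg _)
        _ < (p : ℝ)⁻¹ := by rw [one_mul]; exact hG'
  rw [hιZ, norm_algebraMap_comp_apply, hres] at hnorm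
  exact lt_irrefl _ hnorm

end Residual

/-! ## §3. From common zeros to common height-one primes -/

section Primes

/-- **NO COMMON HEIGHT-ONE PRIME under residual separation.** `F, G ∈ Λ ∖ {0}`, `μ = 0`,
`‖F_0‖ = ‖G_0‖ = 1/p`, `λ(F) = λ(G)`, `‖F_0·G_λ − G_0·F_λ‖ = 1/p`: no height-one prime of `Λ = ℤ_p⟦T⟧`
contains both (`(p)` by `μ(F) = 0`; `(f)`, `f` distinguished irreducible, by its common zero in `ℂ_p`).
[cite: Washington1997, §7.1–7.2, Thm. 7.3 and §13.2] [cite: Koblitz1984, Ch. IV §4 (Newton polygon of a power series)] -/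
theorem not_mem_and_mem_of_residual {F G : IwasawaAlgebra p} (hF0 : F ≠ 0) (hG0 : G ≠ 0)
    (hμF : mu F = 0) (hμG : mu G = 0)
    (hF : ‖PowerSeries.constantCoeff F‖ = (p : ℝ)⁻¹) (hG : ‖PowerSeries.constantCoeff G‖ = (p : ℝ)⁻¹)
    (hlam : lam F = lam G)
    (hres : ‖PowerSeries.constantCoeff F * PowerSeries.coeff (lam G) G -
      PowerSeries.constantCoeff G * PowerSeries.coeff (lam F) F‖ = (p : ℝ)⁻¹)
    (𝔭 : PrimeSpectrum (IwasawaAlgebra p)) (h𝔭 : 𝔭.asIdeal.height = 1) :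
    ¬ (F ∈ 𝔭.asIdeal ∧ G ∈ 𝔭.asIdeal) := by
  rintro ⟨hF𝔭, hG𝔭⟩
  rcases IwasawaAlgebra.eq_span_of_height_eq_one p 𝔭.asIdeal h𝔭 with hp𝔭 | ⟨f, hf, hirr, hf𝔭⟩
  · rw [hp𝔭, Ideal.mem_span_singleton] at hF𝔭
    have h1 : 1 ≤ mu F := le_mu_of_C_pow_dvd hF0 (by rwa [pow_one])
    omega
  · obtain ⟨z, hz, hzero⟩ := exists_common_zero_of_span_distinguished hf hirr
    rw [hf𝔭] at hF𝔭 hG𝔭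
    exact not_common_zero_of_residual hF0 hG0 hμF hμG hF hG hlam hres hz (hzero F hF𝔭) (hzero G hG𝔭)

/-- **The `T`-shifted form.** If `F = T·F₁`, `G = T·G₁` with `F₁, G₁` as in `not_mem_and_mem_of_residual`,
no height-one prime other than `(T)` contains both `F` and `G`. [cite: Washington1997, §7.1–7.2, Thm. 7.3 and §13.2] -/
theorem not_mem_and_mem_of_X_mul_of_residual {F G F₁ G₁ : IwasawaAlgebra p}
    (hFF : F = PowerSeries.X * F₁) (hGG : G = PowerSeries.X * G₁) (hF0 : F₁ ≠ 0) (hG0 : G₁ ≠ 0)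
    (hμF : mu F₁ = 0) (hμG : mu G₁ = 0)
    (hF : ‖PowerSeries.constantCoeff F₁‖ = (p : ℝ)⁻¹) (hG : ‖PowerSeries.constantCoeff G₁‖ = (p : ℝ)⁻¹)
    (hlam : lam F₁ = lam G₁)
    (hres : ‖PowerSeries.constantCoeff F₁ * PowerSeries.coeff (lam G₁) G₁ -
      PowerSeries.constantCoeff G₁ * PowerSeries.coeff (lam F₁) F₁‖ = (p : ℝ)⁻¹)
    (𝔭 : PrimeSpectrum (IwasawaAlgebra p)) (h𝔭 : 𝔭.asIdeal.height = 1)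
    (hT : (PowerSeries.X : IwasawaAlgebra p) ∉ 𝔭.asIdeal) :
    ¬ (F ∈ 𝔭.asIdeal ∧ G ∈ 𝔭.asIdeal) := by
  rintro ⟨hF𝔭, hG𝔭⟩
  rw [hFF] at hF𝔭
  rw [hGG] at hG𝔭
  exact not_mem_and_mem_of_residual hF0 hG0 hμF hμG hF hG hlam hres 𝔭 h𝔭
    ⟨(𝔭.isPrime.mem_or_mem hF𝔭).resolve_left hT, (𝔭.isPrime.mem_or_mem hG𝔭).resolve_left hT⟩

/-- **First- or second-order separation.** `F, G ∈ Λ ∖ {0}`, `μ = 0`, `‖F_0‖ = ‖G_0‖ = 1/p`, and EITHER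
`λ(F) ≠ λ(G)` OR `‖F_0·G_{λ(G)} − G_0·F_{λ(F)}‖ = 1/p`: no height-one prime contains both.
[cite: Washington1997, §7.1–7.2, Thm. 7.3 and §13.2] [cite: Koblitz1984, Ch. IV §4 (Newton polygon of a power series)] -/
theorem not_mem_and_mem_of_lam_ne_or_residual {F G : IwasawaAlgebra p} (hF0 : F ≠ 0) (hG0 : G ≠ 0)
    (hμF : mu F = 0) (hμG : mu G = 0)
    (hF : ‖PowerSeries.constantCoeff F‖ = (p : ℝ)⁻¹) (hG : ‖PowerSeries.constantCoeff G‖ = (p : ℝ)⁻¹)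
    (hsep : lam F ≠ lam G ∨
      ‖PowerSeries.constantCoeff F * PowerSeries.coeff (lam G) G -
        PowerSeries.constantCoeff G * PowerSeries.coeff (lam F) F‖ = (p : ℝ)⁻¹)
    (𝔭 : PrimeSpectrum (IwasawaAlgebra p)) (h𝔭 : 𝔭.asIdeal.height = 1) :
    ¬ (F ∈ 𝔭.asIdeal ∧ G ∈ 𝔭.asIdeal) := by
  by_cases hlam : lam F = lam G
  · have hres := hsep.resolve_left (not_not.mpr hlam)
    exact not_mem_and_mem_of_residual hF0 hG0 hμF hμG hF hG hlam hres 𝔭 h𝔭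
  · exact not_mem_and_mem_of_lam_ne hF0 hG0 hμF hμG hF hG hlam 𝔭 h𝔭

end Primes



end Summit.BirchSwinnertonDyer.BirchSwinnertonDyer.Theorems.ChromaticSlopeSeparation

end
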